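import Literature.Algebra.Homology.RepExtGroupCohomologyDegreeZero
import Literature.Algebra.Homology.ExtMapExactFunctorNaturality
import HarnessLib

/-!
# `Extⁿ_{Rep k G}(k, A) ≃+ Hⁿ(G, A)` commutes with change of group (restriction / inflation)

Topic `Algebra/Homology`; namespace `Literature.Algebra.Homology.RepExt`.  Theorems only; no
definition, no named fact, no instance, no `sorry`.  Sequel of `RepExtGroupCohomologyDegreeZero`
((U0): `((H0Iso A).hom (E_A 0 (mk₀ a))).1 = a(1)`) and `RepExtGroupCohomologyDelta` (the dictionary
commutes with connecting homomorphisms), using the tree's dévissage `ExtFunctoriality.ext_induction`.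

For a group homomorphism `f : G →* H` Mathlib has, on the one hand, the exact restriction functor
`Rep.resFunctor f : Rep k H ⥤ Rep k G` and the induced map `Ext.mapExactFunctor (Rep.resFunctor f)` on
the derived-category `Ext`, and on the other hand `groupCohomology.map f φ n : Hⁿ(H, A) → Hⁿ(G, B)`
on inhomogeneous cochains.  The dictionary `E_A n = RepExt.extTrivialAddEquivGroupCohomology A n`
intertwines them:

* `extTrivialAddEquivGroupCohomology_comp_extClass'`: the δ-compatibility of `RepExtGroupCohomologyDelta`
  in the uniform indexing `n → n + 1`;
* `map_δ`: **change of group commutes with the connecting homomorphisms** of `groupCohomology`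
  (`map f 𝟙 (δ_S x) = δ_{res S} (map f 𝟙 x)`; Mathlib records `δ_naturality` only for a fixed group);
* **`extTrivialAddEquivGroupCohomology_mapExactFunctor`**:
  `E_{res f A} n (x.mapExactFunctor (Rep.resFunctor f)) = groupCohomology.map f (𝟙 (res f A)) n (E_A n x)`
  for every `x ∈ Extⁿ_{Rep k H}(k, A)` — by dimension shifting: degree `0` is (U0) on both sides
  (`map_H0Iso_hom_f`), and both sides are δ-morphisms;
* `extTrivialAddEquivGroupCohomology_mapExactFunctor_comp`: the general form
  `E_B n ((x.mapExactFunctor (res f)) ≫ φ) = groupCohomology.map f φ n (E_A n x)` for `φ : res f A ⟶ B`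
  (with the naturality in the coefficients of `RepExtGroupCohomologyNaturality`), and the `symm` forms.

Written for Route A of crux `stmt-BirchSwinnertonDyer-19295` (cell `bsd-schneider-ideate`, seat
door-c4 gen 15): item (N1) of FINDING-door-c4-g14 §7.  With it the layer transitions
`DiscreteRep.LayerColimit.step` / `extInfStep` of the colimit theorem (d)
(`Extⁿ_{C_Γ}(k, M) = lim→_U Extⁿ_{Rep k (Γ⧸U)}(k, M^U)`) become Mathlib's inflation maps
`groupCohomology.map (Γ⧸V → Γ⧸U) (M^U ⊆ M^V)` (sequel), so that the cell's finite-layer theorems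
(stated in `groupCohomology`) plug into (d) verbatim.  HONEST FRAMING: homological algebra only.

## References
* K. S. Brown, *Cohomology of Groups*, GTM 87 (1982), III §8 (functoriality `(α, f)^*`, computed on
  any projective resolutions; compatibility with long exact sequences). [Brown1982CohomologyGroups]
* C. A. Weibel, *An introduction to homological algebra* (1994), §2.4 (Exercise 2.4.3, dimension
  shifting), §6.7 (restriction / inflation). [Weibel1994]
-/

noncomputable section

universe u

namespace Literature.Algebra.Homology

namespace RepExt

open CategoryTheory CategoryTheory.Limits CategoryTheory.Abelian

variable {k G H : Type u} [CommRing k] [Group G] [Group H]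

/-! ## §1 Uniform indexing of the δ-compatibility -/

/-- `E_{X₁} (n+1) (z ∘ [S]) = groupCohomology.δ hS n (n+1) (E_{X₃} n z)` for every `n`
(`RepExtGroupCohomologyDelta`, both cases). [cite: Brown1982CohomologyGroups, III (6.1)] -/
theorem extTrivialAddEquivGroupCohomology_comp_extClass' {S : ShortComplex (Rep.{u} k G)}
    (hS : S.ShortExact) (n : ℕ) (z : Ext (Rep.trivial k G k) S.X₃ n) :
    extTrivialAddEquivGroupCohomology S.X₁ (n + 1) (z.comp hS.extClass (rfl : n + 1 = n + 1)) =
      groupCohomology.δ hS n (n + 1) rfl (extTrivialAddEquivGroupCohomology S.X₃ n z) := by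
  cases n with
  | zero => exact extTrivialAddEquivGroupCohomology_comp_extClass_zero hS z
  | succ n => exact extTrivialAddEquivGroupCohomology_comp_extClass hS n z

/-! ## §2 Change of group commutes with the connecting homomorphisms -/

section Delta

variable (f : G →* H) {S : ShortComplex (Rep.{u} k H)}

/-- The restriction of a short exact sequence along `f` (the tree's reducible `mapSC`) is short
exact. [cite: Weibel1994, §6.7] -/
theorem mapSC_res_shortExact (hS : S.ShortExact) :
    (ExtFunctoriality.mapSC (Rep.resFunctor f) S).ShortExact :=
  ExtFunctoriality.mapSC_shortExact (Rep.resFunctor f) hS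

/-- **`groupCohomology.map` commutes with `groupCohomology.δ` under change of group**: for
`f : G →* H` and a short exact sequence `S` of `H`-representations,
`map f 𝟙 (δ_S x) = δ_{res_f S} (map f 𝟙 x)` (naturality of `δ` for the morphism of short exact
sequences of cochain complexes `C•(H, S) ⟶ C•(G, res_f S)` given by `cochainsMap f 𝟙`).
[cite: Brown1982CohomologyGroups, III §8][cite: Weibel1994, §6.7] -/
theorem map_δ (hS : S.ShortExact) (i j : ℕ) (hij : i + 1 = j) (x : groupCohomology S.X₃ i) :
    groupCohomology.map f (𝟙 (Rep.res f S.X₁)) j (groupCohomology.δ hS i j hij x) =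
      groupCohomology.δ (mapSC_res_shortExact f hS) i j hij
        (groupCohomology.map f (𝟙 (Rep.res f S.X₃)) i x) := by
  let φ : S.map (groupCohomology.cochainsFunctor k H) ⟶
      (ExtFunctoriality.mapSC (Rep.resFunctor f) S).map (groupCohomology.cochainsFunctor k G) :=
    { τ₁ := groupCohomology.cochainsMap f (𝟙 (Rep.res f S.X₁))
      τ₂ := groupCohomology.cochainsMap f (𝟙 (Rep.res f S.X₂))
      τ₃ := groupCohomology.cochainsMap f (𝟙 (Rep.res f S.X₃))
      comm₁₂ := rfl
      comm₂₃ := rfl }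
  have nat := HomologicalComplex.HomologySequence.δ_naturality φ
    (groupCohomology.map_cochainsFunctor_shortExact hS)
    (groupCohomology.map_cochainsFunctor_shortExact (mapSC_res_shortExact f hS)) i j hij
  exact LinearMap.congr_fun (congrArg ModuleCat.Hom.hom nat) x

end Delta

/-! ## §3 The dictionary commutes with change of group -/

section Main

variable (f : G →* H)

/-- Degree `0`: both sides of the compatibility have invariant vector `a(1)`.
[cite: Brown1982CohomologyGroups, III §8] -/
theorem extTrivialAddEquivGroupCohomology_mapExactFunctor_mk₀ {A : Rep.{u} k H}
    (a : Rep.trivial k H k ⟶ A) :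
    extTrivialAddEquivGroupCohomology (Rep.res f A) 0 ((Ext.mk₀ a).mapExactFunctor (Rep.resFunctor f)) =
      groupCohomology.map f (𝟙 (Rep.res f A)) 0 (extTrivialAddEquivGroupCohomology A 0 (Ext.mk₀ a)) := by
  rw [Ext.mapExactFunctor_mk₀]
  apply groupCohomology_zero_ext
  -- left: (U0) for the restricted morphism `res a : k ⟶ res A`
  have h1 : ((groupCohomology.H0Iso (Rep.res f A)).hom
      (extTrivialAddEquivGroupCohomology (Rep.res f A) 0
        (Ext.mk₀ (show Rep.trivial k G k ⟶ Rep.res f A from (Rep.resFunctor f).map a)))).1 =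
      a.hom (1 : k) :=
    H0Iso_hom_extTrivialAddEquivGroupCohomology_mk₀ (Rep.res f A) _
  -- right: `map f 𝟙 0` is the inclusion of invariants, then (U0) for `a`
  have h2 := groupCohomology.map_H0Iso_hom_f_apply f (𝟙 (Rep.res f A))
    (extTrivialAddEquivGroupCohomology A 0 (Ext.mk₀ a))
  rw [groupCohomology.shortComplexH0_f, groupCohomology.shortComplexH0_f] at h2
  change ((groupCohomology.H0Iso (Rep.res f A)).hom
      (groupCohomology.map f (𝟙 (Rep.res f A)) 0
        (extTrivialAddEquivGroupCohomology A 0 (Ext.mk₀ a)))).1 =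
    ((groupCohomology.H0Iso A).hom (extTrivialAddEquivGroupCohomology A 0 (Ext.mk₀ a))).1 at h2
  rw [H0Iso_hom_extTrivialAddEquivGroupCohomology_mk₀] at h2
  exact h1.trans h2.symm

/-- **The dictionary `Extⁿ_{Rep}(k, –) ≃+ Hⁿ` commutes with change of group.**  For a group
homomorphism `f : G →* H`, an `H`-representation `A` and `x ∈ Extⁿ_{Rep k H}(k, A)`:
`E_{res f A} n (res_f x) = groupCohomology.map f (𝟙 (res f A)) n (E_A n x)`, where
`res_f x = x.mapExactFunctor (Rep.resFunctor f)` (restriction is exact) and `groupCohomology.map f 𝟙`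
is Mathlib's map on inhomogeneous cochains `c ↦ c ∘ fⁿ`.  Proof by dimension shifting
(`ExtFunctoriality.ext_induction`): degree `0` is the previous lemma, and both sides intertwine the
connecting homomorphisms (`extTrivialAddEquivGroupCohomology_comp_extClass'`, `map_δ`,
`Ext.mapExactFunctor_comp`, `mapExactFunctor_extClass`).
[cite: Brown1982CohomologyGroups, III §8][cite: Weibel1994, §2.4 (Exercise 2.4.3), §6.7] -/
theorem extTrivialAddEquivGroupCohomology_mapExactFunctor {A : Rep.{u} k H} {n : ℕ}
    (x : Ext (Rep.trivial k H k) A n) :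
    extTrivialAddEquivGroupCohomology (Rep.res f A) n (x.mapExactFunctor (Rep.resFunctor f)) =
      groupCohomology.map f (𝟙 (Rep.res f A)) n (extTrivialAddEquivGroupCohomology A n x) := by
  refine ExtFunctoriality.ext_induction (Rep.trivial k H k)
    (P := fun B n x =>
      extTrivialAddEquivGroupCohomology (Rep.res f B) n (x.mapExactFunctor (Rep.resFunctor f)) =
        groupCohomology.map f (𝟙 (Rep.res f B)) n (extTrivialAddEquivGroupCohomology B n x))
    (fun B a => ?_) (fun S hS n y hy => ?_) x
  · beta_reduce
    exact extTrivialAddEquivGroupCohomology_mapExactFunctor_mk₀ f a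
  · beta_reduce at hy ⊢
    have e1 : (y.comp hS.extClass (rfl : n + 1 = n + 1)).mapExactFunctor (Rep.resFunctor f) =
        (y.mapExactFunctor (Rep.resFunctor f)).comp (mapSC_res_shortExact f hS).extClass
          (rfl : n + 1 = n + 1) := by
      rw [Ext.mapExactFunctor_comp, ExtFunctoriality.mapExactFunctor_extClass']
    have e2 : extTrivialAddEquivGroupCohomology (Rep.res f S.X₁) (n + 1)
        ((y.mapExactFunctor (Rep.resFunctor f)).comp (mapSC_res_shortExact f hS).extClass
          (rfl : n + 1 = n + 1)) =
        groupCohomology.δ (mapSC_res_shortExact f hS) n (n + 1) rfl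
          (extTrivialAddEquivGroupCohomology (Rep.res f S.X₃) n (y.mapExactFunctor (Rep.resFunctor f))) :=
      extTrivialAddEquivGroupCohomology_comp_extClass' (mapSC_res_shortExact f hS) n _
    rw [e1, e2, hy, extTrivialAddEquivGroupCohomology_comp_extClass' hS n y, map_δ f hS n (n + 1) rfl]

/-- **General form**: for `φ : res f A ⟶ B`,
`E_B n (res_f x ≫ φ) = groupCohomology.map f φ n (E_A n x)` (Mathlib's `groupCohomology.map f φ`
factors as `map f 𝟙 ≫ map id φ`). [cite: Brown1982CohomologyGroups, III §8] -/
theorem extTrivialAddEquivGroupCohomology_mapExactFunctor_comp {A : Rep.{u} k H} {B : Rep.{u} k G}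
    (φ : Rep.res f A ⟶ B) {n : ℕ} (x : Ext (Rep.trivial k H k) A n) :
    extTrivialAddEquivGroupCohomology B n
        ((x.mapExactFunctor (Rep.resFunctor f)).comp (Ext.mk₀ φ) (add_zero n)) =
      groupCohomology.map f φ n (extTrivialAddEquivGroupCohomology A n x) := by
  have h := extTrivialAddEquivGroupCohomology_naturality φ n
    (show Ext (Rep.trivial k G k) (Rep.res f A) n from x.mapExactFunctor (Rep.resFunctor f))
  have hmap : groupCohomology.map f φ n =
      groupCohomology.map f (𝟙 (Rep.res f A)) n ≫ groupCohomology.map (MonoidHom.id G) φ n := by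
    rw [← groupCohomology.map_comp]
    rfl
  rw [hmap, ModuleCat.comp_apply, ← extTrivialAddEquivGroupCohomology_mapExactFunctor f x]
  exact h

/-- Inverse form: `E_{res f A}⁻¹ (map f 𝟙 y) = res_f (E_A⁻¹ y)`. [cite: Brown1982CohomologyGroups, III §8] -/
theorem extTrivialAddEquivGroupCohomology_symm_map {A : Rep.{u} k H} {n : ℕ} (y : groupCohomology A n) :
    (extTrivialAddEquivGroupCohomology (Rep.res f A) n).symm
        (groupCohomology.map f (𝟙 (Rep.res f A)) n y) =
      ((extTrivialAddEquivGroupCohomology A n).symm y).mapExactFunctor (Rep.resFunctor f) := by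
  apply (extTrivialAddEquivGroupCohomology (Rep.res f A) n).injective
  rw [AddEquiv.apply_symm_apply, extTrivialAddEquivGroupCohomology_mapExactFunctor,
    AddEquiv.apply_symm_apply]

/-- Inverse form with coefficients: `E_B⁻¹ (map f φ y) = res_f (E_A⁻¹ y) ≫ φ`.
[cite: Brown1982CohomologyGroups, III §8] -/
theorem extTrivialAddEquivGroupCohomology_symm_map_comp {A : Rep.{u} k H} {B : Rep.{u} k G}
    (φ : Rep.res f A ⟶ B) {n : ℕ} (y : groupCohomology A n) :
    (extTrivialAddEquivGroupCohomology B n).symm (groupCohomology.map f φ n y) =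
      (((extTrivialAddEquivGroupCohomology A n).symm y).mapExactFunctor (Rep.resFunctor f)).comp
        (Ext.mk₀ φ) (add_zero n) := by
  apply (extTrivialAddEquivGroupCohomology B n).injective
  rw [AddEquiv.apply_symm_apply, extTrivialAddEquivGroupCohomology_mapExactFunctor_comp,
    AddEquiv.apply_symm_apply]

end Main

end RepExt

end Literature.Algebra.Homology
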